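import Mathlib
import Literature.Probability.Percolation.Percolation
import Literature.Probability.LatticeModels.TriangularLattice
import Literature.Probability.Percolation.FullPlaneCNL
import Literature.Probability.Percolation.SiteLoopDensity
import Literature.Probability.RandomPlanarGeometry.LoopConfigurations
import Literature.Probability.RandomPlanarGeometry.UnbasedLoopSpace
import Summits.CriticalPhenomena.CardyFormulaZ2.Theorems.CardyMagicRigidityHexSegmentDefs
import Summits.CriticalPhenomena.CardyFormulaZ2.Theorems.CardyMagicRigidityLoopLimitZ2EqTSiteEndLaw
import HarnessLib

/-!
# Stub `stub_siteEnd` (S2) of line `Sketch`, crux `LoopLimitZ2EqT` (stmt-CriticalPhenomena-4833):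
# assembly of `SiteEndLoops` from the pathwise loop dictionary

Helper file (`--supports stmt-CriticalPhenomena-4833`), continuation of
`CardyMagicRigidityLoopLimitZ2EqTSiteEndLaw.lean`, which reduced the endpoint dictionary
`SiteEndLoops` (S2 of `CardyMagicRigidityHexSegmentDefs.lean`) to the convergence
`d_CN((P_{1/2}, siteLoopConfig δ), (P_{1/2}, τ ↦ siteLoopConfig (δ/2) (refine (A τ)))) → 0`
(`siteEnd_of_tendsto`) and identified `refine (A τ)` with the blow-up
`β τ := {v | (∀ i, 2 ∣ v i) ∨ ⌊v/2⌋ ∈ τ}` of the cell set `τ` (`siteEnd_refine_upEdge_eq`).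
Here that convergence, hence `SiteEndLoops`, is derived (`siteEnd_tendsto_of_loopDictionary`,
`siteEnd_of_loopDictionary`) from the **deterministic loop dictionary** (the one remaining input,
taken as an explicit hypothesis, to be proved as a separate sub-goal):

  `∃ C, ∀ δ > 0, ∀ τ, ∀ i, (∀ u ∈ (siteLoopConfig δ τ).F i, ∃ u' ∈ (siteLoopConfig (δ/2) (β τ)).F i,
      d(u, u') ≤ C δ) ∧ (∀ u' ∈ (siteLoopConfig (δ/2) (β τ)).F i,
      (∃ u ∈ (siteLoopConfig δ τ).F i, d(u', u) ≤ C δ) ∨ diam u' ≤ C δ)`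

— every honeycomb interface loop of `τ` at mesh `δ` is tracked, within DKKMO's distance
`d = udist ≤ C δ` and with the same type (orientation), by an interface loop of the blow-up at
mesh `δ/2` (the boundary of the blown-up cluster with its pendant corners), and every interface
loop of the blow-up is either such a tracking loop or dust of diameter `O(δ)` (the hexagons around
isolated open corners `2x`, `x, x - e₀, x - e₁ ∉ τ`). Probability enters only through the tree's
density theorem `tendsto_measure_setOf_sparse_siteLoopConfig` (`SiteLoopDensity.lean`:
microscopic loops of both types of `P_{1/2}` are everywhere in the window w.h.p.), which matches
the dust: with the diagonal coupling `τ ↦ (τ, τ)` of `P_{1/2}` with itself, the exceptional event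
`{d_CN > η}` is contained in the sparse event (`siteEnd_isClose_of_dictionary`: a dust loop in the
window and a small loop of the same type near one of its points lie in a common ball of radius
`η/2`, `UnbasedLoop.udist_le_of_subset_closedBall`).
-/

noncomputable section

open MeasureTheory Set Filter
open scoped Topology ENNReal

namespace Summit.CriticalPhenomena.CardyFormulaZ2.Cruxes.LoopLimitZ2EqT.HexSegment

open Literature.Probability.Percolation Literature.Probability.LatticeModels
  Literature.Probability.RandomPlanarGeometry

/-! ### Assembly: S2 from the pathwise loop dictionary and the density of small loops -/

/-- The blow-up map `τ ↦ {v | (∀ i, 2 ∣ v i) ∨ ⌊v/2⌋ ∈ τ}` is measurable. -/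
theorem siteEnd_measurable_blowup :
    Measurable fun τ : SiteConfig (Site 2) =>
      ({v : Site 2 | (∀ i, (2 : ℤ) ∣ v i) ∨ (fun i => v i / 2) ∈ τ} : SiteConfig (Site 2)) :=
  measurable_set_iff.2 fun _ => measurable_const.or (measurable_set_mem _)

/-- Measurability of the exceptional event of `d_CN` between the honeycomb loops of `τ` at mesh
`δ` and the honeycomb loops of the blow-up of `τ'` at mesh `δ/2`. -/
theorem siteEnd_measurableSet_isClose_blowup (δ ε : ℝ) :
    MeasurableSet {p : SiteConfig (Site 2) × SiteConfig (Site 2) |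
      LoopConfig.IsClose ε (siteLoopConfig δ p.1) (siteLoopConfig (δ / 2)
        {v : Site 2 | (∀ i, (2 : ℤ) ∣ v i) ∨ (fun i => v i / 2) ∈ p.2})} :=
  (measurable_id.prodMap siteEnd_measurable_blowup) (measurableSet_isClose_siteLoopConfig δ (δ / 2) ε)

/-- **Pathwise step.** If every coarse loop has a fine partner of its type within `C δ ≤ η/2`,
every fine loop either has a coarse partner of its type within `C δ` or has diameter `≤ C δ`
(dust), and the coarse configuration has loops of both types inside `ball z (η/2)` for every `z`
of the window `closedBall 0 (1/η)` (density), then the two typed configurations are `η`-close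
in DKKMO's sense: a dust loop `u'` in the window and a small coarse loop near a point of `u'`
both lie in a ball of radius `η/2`, hence `d(u', u) ≤ η` (`udist_le_of_subset_closedBall`). -/
theorem siteEnd_isClose_of_dictionary {C δ η : ℝ} (hη : 0 < η) (hCδ : C * δ ≤ η / 2)
    {c c' : LoopConfig ℂ}
    (hdict : ∀ i : Fin 2, (∀ u ∈ c.F i, ∃ u' ∈ c'.F i, u.udist u' ≤ C * δ) ∧
      (∀ u' ∈ c'.F i, (∃ u ∈ c.F i, u'.udist u ≤ C * δ) ∨ Metric.diam u'.range ≤ C * δ))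
    (hdense : ∀ z ∈ Metric.closedBall (0 : ℂ) (1 / η), ∀ i : Fin 2,
      ∃ u ∈ c.F i, u.range ⊆ Metric.ball z (η / 2)) :
    LoopConfig.IsClose η c c' := by
  intro i
  obtain ⟨h1, h2⟩ := hdict i
  refine ⟨fun u hu _ => ?_, fun u' hu' hr => ?_⟩
  · obtain ⟨u', hu', hd⟩ := h1 u hu
    exact ⟨u', hu', hd.trans (by linarith)⟩
  · rcases h2 u' hu' with ⟨u, hu, hd⟩ | hdiam
    · exact ⟨u, hu, hd.trans (by linarith)⟩
    · obtain ⟨z, hz⟩ := u'.range_nonempty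
      have hz' : z ∈ Metric.closedBall (0 : ℂ) (1 / η) := Metric.ball_subset_closedBall (hr hz)
      obtain ⟨u, hu, hur⟩ := hdense z hz' i
      refine ⟨u, hu, ?_⟩
      have hs₁ : u'.range ⊆ Metric.closedBall z (η / 2) := fun w hw =>
        Metric.mem_closedBall.2 <|
          (Metric.dist_le_diam_of_mem u'.isCompact_range.isBounded hw hz).trans (hdiam.trans hCδ)
      have hs₂ : u.range ⊆ Metric.closedBall z (η / 2) := hur.trans Metric.ball_subset_closedBall
      calc u'.udist u ≤ 2 * (η / 2) := UnbasedLoop.udist_le_of_subset_closedBall (by linarith) hs₁ hs₂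
        _ = η := by ring

/-- **(5b) From the loop dictionary to `d_CN → 0`.** If, deterministically at every mesh
`δ > 0` and for every cell set `τ`, every honeycomb loop of `τ` of type `i` (mesh `δ`) has a
honeycomb loop of the blow-up of `τ` of type `i` (mesh `δ/2`) within `d ≤ C δ`, and conversely
up to dust of diameter `≤ C δ`, then `d_CN((P_{1/2}, siteLoopConfig δ), (P_{1/2}, blow-up
loops)) → 0`: the diagonal coupling `τ ↦ (τ, τ)` has its exceptional event inside the sparse
event of `tendsto_measure_setOf_sparse_siteLoopConfig` (no small loop of some type near some
point of the window), whose probability tends to `0`. -/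
theorem siteEnd_tendsto_of_loopDictionary :
    (∃ C : ℝ, ∀ δ : ℝ, 0 < δ → ∀ (τ : SiteConfig (Site 2)) (i : Fin 2),
      (∀ u ∈ (siteLoopConfig δ τ).F i, ∃ u' ∈ (siteLoopConfig (δ / 2)
          {v : Site 2 | (∀ j, (2 : ℤ) ∣ v j) ∨ (fun j => v j / 2) ∈ τ}).F i, u.udist u' ≤ C * δ) ∧
      (∀ u' ∈ (siteLoopConfig (δ / 2)
          {v : Site 2 | (∀ j, (2 : ℤ) ∣ v j) ∨ (fun j => v j / 2) ∈ τ}).F i,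
        (∃ u ∈ (siteLoopConfig δ τ).F i, u'.udist u ≤ C * δ) ∨ Metric.diam u'.range ≤ C * δ)) →
    Tendsto (fun δ : ℝ => LoopConfig.cnLawEDist (triSitePercolation half) (siteLoopConfig δ)
      (triSitePercolation half) (fun τ : SiteConfig (Site 2) => siteLoopConfig (δ / 2)
        {v : Site 2 | (∀ j, (2 : ℤ) ∣ v j) ∨ (fun j => v j / 2) ∈ τ})) (𝓝[>] 0) (𝓝 0) := by
  rintro ⟨C₀, hC₀⟩
  set C : ℝ := max C₀ 1 with hC
  have hCpos : 0 < C := lt_max_of_lt_right one_pos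
  have hmono : ∀ {δ : ℝ}, 0 < δ → C₀ * δ ≤ C * δ := fun hδ =>
    mul_le_mul_of_nonneg_right (le_max_left _ _) hδ.le
  rw [ENNReal.tendsto_nhds_zero]
  intro ε hε
  by_cases hεtop : ε = ⊤
  · exact Eventually.of_forall fun δ => hεtop ▸ le_top
  set η : ℝ := ε.toReal with hη
  have hηpos : 0 < η := ENNReal.toReal_pos hε.ne' hεtop
  have hηε : ENNReal.ofReal η = ε := ENNReal.ofReal_toReal hεtop
  have hη2 : (0 : ℝ≥0∞) < ENNReal.ofReal η / 2 :=
    ENNReal.half_pos (ENNReal.ofReal_pos.2 hηpos).ne'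
  have hdense := eventually_measure_setOf_sparse_siteLoopConfig_le (1 / η) (half_pos hηpos) hη2
  have hsmall : ∀ᶠ δ in 𝓝[>] (0 : ℝ), δ < η / (2 * C) :=
    mem_nhdsWithin_of_mem_nhds (Iio_mem_nhds (by positivity : (0 : ℝ) < η / (2 * C)))
  have hmeas : Measurable fun τ : SiteConfig (Site 2) => (τ, τ) := measurable_id.prodMk measurable_id
  filter_upwards [hdense, hsmall, self_mem_nhdsWithin] with δ hD hδs hδ
  have hδ' : (0 : ℝ) < δ := hδ
  have hCδ : C * δ ≤ η / 2 := by
    have h1 := (lt_div_iff₀ (by positivity : (0 : ℝ) < 2 * C)).1 hδs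
    nlinarith
  rw [← hηε]
  refine LoopConfig.cnLawEDist_le_of_coupling hηpos ((triSitePercolation half).map fun τ => (τ, τ))
    ?_ ?_ ?_
  · rw [Measure.map_map measurable_fst hmeas]
    exact Measure.map_id
  · rw [Measure.map_map measurable_snd hmeas]
    exact Measure.map_id
  · rw [← Set.compl_setOf, Measure.map_apply hmeas (siteEnd_measurableSet_isClose_blowup δ η).compl]
    refine lt_of_le_of_lt ((measure_mono ?_).trans hD) (ENNReal.half_lt_self
      (ENNReal.ofReal_pos.2 hηpos).ne' ENNReal.ofReal_ne_top)
    intro τ hτ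
    by_contra hgood
    refine hτ (siteEnd_isClose_of_dictionary (C := C) hηpos hCδ (fun i => ?_) fun z hz i => ?_)
    · obtain ⟨h1, h2⟩ := hC₀ δ hδ' τ i
      exact ⟨fun u hu => (h1 u hu).imp fun u' hu' => ⟨hu'.1, hu'.2.trans (hmono hδ')⟩,
        fun u' hu' => (h2 u' hu').imp (fun hh => hh.imp fun u hu => ⟨hu.1, hu.2.trans (hmono hδ')⟩)
          fun hh => hh.trans (hmono hδ')⟩
    · by_contra hnone
      push Not at hnone
      exact hgood ⟨z, hz, i, fun u hu hsub => hnone u hu hsub⟩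

/-- **S2 from the loop dictionary (4).** `SiteEndLoops` follows from the deterministic
pathwise dictionary between the honeycomb interface loops of a cell set `τ` on `δ𝕋` and the
honeycomb interface loops, at mesh `δ/2`, of its blow-up `{v | (∀ i, 2 ∣ v i) ∨ ⌊v/2⌋ ∈ τ}` (=
`refine` of the all-or-nothing configuration of `τ`, `siteEnd_refine_upEdge_eq`): same-type
partners within `d ≤ C δ` both ways, up to fine dust of diameter `≤ C δ`
(`siteEnd_tendsto_of_loopDictionary`, `siteEnd_of_tendsto`). -/
theorem siteEnd_of_loopDictionary :
    (∃ C : ℝ, ∀ δ : ℝ, 0 < δ → ∀ (τ : SiteConfig (Site 2)) (i : Fin 2),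
      (∀ u ∈ (siteLoopConfig δ τ).F i, ∃ u' ∈ (siteLoopConfig (δ / 2)
          {v : Site 2 | (∀ j, (2 : ℤ) ∣ v j) ∨ (fun j => v j / 2) ∈ τ}).F i, u.udist u' ≤ C * δ) ∧
      (∀ u' ∈ (siteLoopConfig (δ / 2)
          {v : Site 2 | (∀ j, (2 : ℤ) ∣ v j) ∨ (fun j => v j / 2) ∈ τ}).F i,
        (∃ u ∈ (siteLoopConfig δ τ).F i, u'.udist u ≤ C * δ) ∨ Metric.diam u'.range ≤ C * δ)) →
    SiteEndLoops := fun h => by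
  refine siteEnd_of_tendsto ?_
  have e : ∀ δ : ℝ, (fun τ : SiteConfig (Site 2) => siteLoopConfig (δ / 2)
      (refine {e | ∃ (x : Site 2) (k : Fin 3), e = upEdge x k ∧ x ∈ τ})) =
      fun τ : SiteConfig (Site 2) => siteLoopConfig (δ / 2)
        {v : Site 2 | (∀ j, (2 : ℤ) ∣ v j) ∨ (fun j => v j / 2) ∈ τ} :=
    fun δ => funext fun τ => by rw [siteEnd_refine_upEdge_eq τ]
  simp_rw [e]
  exact siteEnd_tendsto_of_loopDictionary h

end Summit.CriticalPhenomena.CardyFormulaZ2.Cruxes.LoopLimitZ2EqT.HexSegment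

end
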